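import Summits.Ventures.HodgeRepro.TwistedQuadAllCore

/-!
# Route-2's Theorem T (i), `ε = +`, for EVERY even `k ≥ 4` — one kernel theorem

Blind re-derivation cell `pub-hodge-repro`, seat `p1` (gen 12).  Theorem T sub-case (i) with `ε = +`
(INBOX L1177, ROUTE-B §9.39): `v` of order `2k` (`k` even), `c = v^k`, an involution `u ∉ ⟨v⟩` with
`u v u⁻¹ = c v = v^{k+1}`; `Δ_T = {1, u, v, vu}`.  The files `TwistedQuadGen` / `K8K12` decided the cases
`k = 4, 6, 8`; here is the general theorem `exists_twistedRectQuad_pos`, for every `k = 2j ≥ 4`, in every finite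
`(G, c)` — route-2's existence half of Theorem T (i) `ε = +` in full generality.  The CM type is the UNIFORM family
found from the decided cases (proofs/p1-g12/tfamily.py, verified for `k = 4, …, 16`): on the model
`ℤ/4j ⋊ ℤ/2` (`u` acting by `x ↦ (2j + 1) x`), in coordinates `(a, g) ↦ vᵃ uᵍ`,
`f₁(a) = [a < 2j]` on the `u`-coset and `f₀(a) = [a odd] ⊕ [a ≥ 2j]` on `⟨v⟩`.  The three local conditions are
proved symbolically (the `ℤ/4j`-arithmetic of `val` from `TwistedQuadAllCore`, then case splits and `omega`), and
gen 10's pattern theorem transports the type (`TwistedQuadGen.exists_twistedRectQuad_of_model`).  The instance on the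
model `ℤ/4j ⋊ ℤ/2` itself for every `j ≥ 2` is `TwistedQuadAllInst.exists_twistedRectQuad_pos_on_model`.
-/

set_option autoImplicit false

open Finset Multiplicative
open scoped Pointwise

namespace HodgeRepro.TwistedQuadGen

open HodgeRepro.CosetQuad

variable (j : ℕ) [NeZero j]

/-! ### The multiplier `s = 2j + 1` -/

/-- `s = 2j + 1 ∈ ℤ/4j`. -/
def sPos : ZMod (4 * j) := ((2 * j + 1 : ℕ) : ZMod (4 * j))

omit [NeZero j] in
/-- `4j = 0` in `ℤ/4j`. -/
theorem four_j_cast : ((4 * j : ℕ) : ZMod (4 * j)) = 0 := ZMod.natCast_self _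

omit [NeZero j] in
/-- `s² = 1`. -/
theorem sPos_sq : sPos j * sPos j = 1 := by
  rw [sPos, ← Nat.cast_mul, show (2 * j + 1) * (2 * j + 1) = (4 * j) * (j + 1) + 1 by ring, Nat.cast_add,
    Nat.cast_mul, four_j_cast, zero_mul, zero_add, Nat.cast_one]

omit [NeZero j] in
/-- `(2j + 1).val = 2j + 1`. -/
theorem sPos_val (hj : 1 ≤ j) : (sPos j).val = 2 * j + 1 := val_natCast_lt _ (by omega)

omit [NeZero j] in
/-- `s · 2j = 2j` in `ℤ/4j`. -/
theorem sPos_mul_half : sPos j * ((2 * j : ℕ) : ZMod (4 * j)) = ((2 * j : ℕ) : ZMod (4 * j)) := by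
  rw [sPos, ← Nat.cast_mul, show (2 * j + 1) * (2 * j) = (4 * j) * j + 2 * j by ring, Nat.cast_add,
    Nat.cast_mul, four_j_cast, zero_mul, zero_add]

omit [NeZero j] in
/-- `−s = 2j − 1` in `ℤ/4j` (for `j ≥ 1`). -/
theorem neg_sPos (hj : 1 ≤ j) : -sPos j = ((2 * j - 1 : ℕ) : ZMod (4 * j)) := by
  apply neg_eq_of_add_eq_zero_right
  rw [sPos, ← Nat.cast_add, show 2 * j + 1 + (2 * j - 1) = 4 * j by omega, four_j_cast]

omit [NeZero j] in
/-- `−1 = 4j − 1` in `ℤ/4j` (for `j ≥ 1`). -/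
theorem neg_one_cast (hj : 1 ≤ j) : (-1 : ZMod (4 * j)) = ((4 * j - 1 : ℕ) : ZMod (4 * j)) := by
  apply neg_eq_of_add_eq_zero_right
  rw [← Nat.cast_one, ← Nat.cast_add, show 1 + (4 * j - 1) = 4 * j by omega, four_j_cast]

/-! ### `val` of the shifted points -/

/-- Every `a ∈ ℤ/4j` is the cast of a natural number `i < 4j`. -/
theorem exists_natCast_eq (a : ZMod (4 * j)) : ∃ i : ℕ, i < 4 * j ∧ a = ((i : ℕ) : ZMod (4 * j)) :=
  ⟨a.val, ZMod.val_lt a, (ZMod.natCast_zmod_val a).symm⟩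

/-- `(a + 2j).val`. -/
theorem val_add_half (a : ZMod (4 * j)) :
    (a + ((2 * j : ℕ) : ZMod (4 * j))).val = if a.val < 2 * j then a.val + 2 * j else a.val - 2 * j := by
  obtain ⟨i, hi, rfl⟩ := exists_natCast_eq j a
  rw [← Nat.cast_add, val_natCast_lt _ hi]
  split_ifs with h
  · exact val_natCast_lt _ (by omega)
  · rw [val_natCast_sub _ (by omega) (by omega)]; omega

/-- `(a − 1).val`. -/
theorem val_sub_one (hj : 1 ≤ j) (a : ZMod (4 * j)) :
    (a - 1).val = if a.val = 0 then 4 * j - 1 else a.val - 1 := by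
  obtain ⟨i, hi, rfl⟩ := exists_natCast_eq j a
  rw [sub_eq_add_neg, neg_one_cast j hj, ← Nat.cast_add, val_natCast_lt _ hi]
  split_ifs with h
  · rw [h, zero_add]; exact val_natCast_lt _ (by omega)
  · rw [val_natCast_sub _ (by omega) (by omega)]; omega

/-- `(a − s).val` for `s = 2j + 1`. -/
theorem val_sub_sPos (hj : 1 ≤ j) (a : ZMod (4 * j)) :
    (a - sPos j).val = if a.val + 2 * j < 4 * j + 1 then a.val + 2 * j - 1 else a.val - 2 * j - 1 := by
  obtain ⟨i, hi, rfl⟩ := exists_natCast_eq j a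
  rw [sub_eq_add_neg, neg_sPos j hj, ← Nat.cast_add, val_natCast_lt _ hi]
  split_ifs with h
  · rw [val_natCast_lt _ (by omega)]; omega
  · rw [val_natCast_sub _ (by omega) (by omega)]; omega

/-! ### The pattern -/

/-- The `⟨v⟩`-layer pattern `f₀(a) = [a odd] ⊕ [a ≥ 2j]`. -/
def patZ (i : ℕ) : Prop := (i % 2 = 1 ∧ i < 2 * j) ∨ (i % 2 = 0 ∧ 2 * j ≤ i)

/-- The predicate `(patZ j)` is decidable. -/
instance : DecidablePred (patZ j) := fun i => by unfold patZ; infer_instance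

/-- The pattern on the model: `f₁ = [a < 2j]` on the `u`-coset, `f₀ = patZ` on `⟨v⟩`. -/
def patP (p : TwistGroup (4 * j) (sPos j) (sPos_sq j)) : Prop :=
  (p.right = ofAdd 1 ∧ (toAdd p.left).val < 2 * j) ∨ (p.right = ofAdd 0 ∧ patZ j (toAdd p.left).val)

/-- The predicate `(patP j)` is decidable. -/
instance : DecidablePred (patP j) := fun p => by unfold patP; infer_instance

/-- The CM type of the model: the elements satisfying the pattern. -/
def ΦPos : Finset (TwistGroup (4 * j) (sPos j) (sPos_sq j)) := univ.filter (patP j)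

/-- Membership in `ΦPos` on the `⟨v⟩`-layer. -/
theorem mem_ΦPos_zero (a : ZMod (4 * j)) :
    mk (4 * j) (sPos j) (sPos_sq j) a 0 ∈ ΦPos j ↔ patZ j a.val := by
  rw [ΦPos, Finset.mem_filter]
  have h01 : (ofAdd (0 : ZMod 2) : Multiplicative (ZMod 2)) ≠ ofAdd 1 := by decide
  simp only [Finset.mem_univ, true_and, patP, mk, toAdd_ofAdd, h01, false_and, false_or, true_and]

/-- Membership in `ΦPos` on the `u`-coset. -/
theorem mem_ΦPos_one (a : ZMod (4 * j)) :
    mk (4 * j) (sPos j) (sPos_sq j) a 1 ∈ ΦPos j ↔ a.val < 2 * j := by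
  rw [ΦPos, Finset.mem_filter]
  have h10 : (ofAdd (1 : ZMod 2) : Multiplicative (ZMod 2)) ≠ ofAdd 0 := by decide
  simp only [Finset.mem_univ, true_and, patP, mk, toAdd_ofAdd, h10, false_and, or_false, true_and]

/-! ### The four memberships around a point -/

omit [NeZero j] in
/-- `c = mk 2j 0` on the model `ℤ/4j ⋊ ℤ/2`. -/
theorem tc_pos_eq : tc (4 * j) (sPos j) (sPos_sq j) = mk (4 * j) (sPos j) (sPos_sq j) ((2 * j : ℕ) : ZMod (4 * j)) 0 := by
  rw [tc_eq_mk, show (4 * j) / 2 = 2 * j by omega]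

omit [NeZero j] in
/-- `mk a g * c = mk (a + 2j) g` (both layers). -/
theorem mk_mul_tc_pos (a : ZMod (4 * j)) (g : ZMod 2) :
    mk (4 * j) (sPos j) (sPos_sq j) a g * tc (4 * j) (sPos j) (sPos_sq j) =
      mk (4 * j) (sPos j) (sPos_sq j) (a + ((2 * j : ℕ) : ZMod (4 * j))) g := by
  rw [tc_pos_eq, mk_mul, add_zero]
  rcases (show ∀ y : ZMod 2, y = 0 ∨ y = 1 by decide) g with rfl | rfl
  · rw [ZMod.val_zero, pow_zero, one_mul]
  · rw [val_one_two, pow_one, sPos_mul_half]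

/-- The membership predicates at distance `0, u, v, vu` from a `⟨v⟩`-point with value `n`. -/
def M2 (n : ℕ) : Prop := patZ j (if n = 0 then 4 * j - 1 else n - 1)

/-- The predicate `(M2 j)` is decidable. -/
instance : DecidablePred (M2 j) := fun n => by unfold M2; infer_instance

/-- The fourth membership predicate: the `vu`-neighbour lies on the `u`-coset. -/
def M3 (n : ℕ) : Prop := (if n + 2 * j < 4 * j + 1 then n + 2 * j - 1 else n - 2 * j - 1) < 2 * j

/-- The predicate `(M3 j)` is decidable. -/
instance : DecidablePred (M3 j) := fun n => by unfold M3; infer_instance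

/-- The four memberships around `mk a 0`. -/
theorem mems_zero (hj : 1 ≤ j) (a : ZMod (4 * j)) :
    (mk (4 * j) (sPos j) (sPos_sq j) a 0 * (rectT (4 * j) (sPos j) (sPos_sq j) 0)⁻¹ ∈ ΦPos j ↔ patZ j a.val) ∧
    (mk (4 * j) (sPos j) (sPos_sq j) a 0 * (rectT (4 * j) (sPos j) (sPos_sq j) 1)⁻¹ ∈ ΦPos j ↔ a.val < 2 * j) ∧
    (mk (4 * j) (sPos j) (sPos_sq j) a 0 * (rectT (4 * j) (sPos j) (sPos_sq j) 2)⁻¹ ∈ ΦPos j ↔ M2 j a.val) ∧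
    (mk (4 * j) (sPos j) (sPos_sq j) a 0 * (rectT (4 * j) (sPos j) (sPos_sq j) 3)⁻¹ ∈ ΦPos j ↔ M3 j a.val) := by
  refine ⟨?_, ?_, ?_, ?_⟩
  · rw [mk_mul_rectT_inv_zero, mem_ΦPos_zero]
  · rw [mk_mul_rectT_inv_one, zero_add, mem_ΦPos_one]
  · rw [mk_mul_rectT_inv_two, ZMod.val_zero, pow_zero, mem_ΦPos_zero, val_sub_one j hj]; rfl
  · rw [mk_mul_rectT_inv_three, sub_zero, val_one_two, pow_one, zero_add, mem_ΦPos_one, val_sub_sPos j hj]; rfl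

/-- The four memberships around `mk a 1`. -/
theorem mems_one (hj : 1 ≤ j) (a : ZMod (4 * j)) :
    (mk (4 * j) (sPos j) (sPos_sq j) a 1 * (rectT (4 * j) (sPos j) (sPos_sq j) 0)⁻¹ ∈ ΦPos j ↔ a.val < 2 * j) ∧
    (mk (4 * j) (sPos j) (sPos_sq j) a 1 * (rectT (4 * j) (sPos j) (sPos_sq j) 1)⁻¹ ∈ ΦPos j ↔ patZ j a.val) ∧
    (mk (4 * j) (sPos j) (sPos_sq j) a 1 * (rectT (4 * j) (sPos j) (sPos_sq j) 2)⁻¹ ∈ ΦPos j ↔ M3 j a.val) ∧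
    (mk (4 * j) (sPos j) (sPos_sq j) a 1 * (rectT (4 * j) (sPos j) (sPos_sq j) 3)⁻¹ ∈ ΦPos j ↔ M2 j a.val) := by
  have h11 : (1 : ZMod 2) + 1 = 0 := by decide
  refine ⟨?_, ?_, ?_, ?_⟩
  · rw [mk_mul_rectT_inv_zero, mem_ΦPos_one]
  · rw [mk_mul_rectT_inv_one, h11, mem_ΦPos_zero]
  · rw [mk_mul_rectT_inv_two, val_one_two, pow_one, mem_ΦPos_one, val_sub_sPos j hj]; rfl
  · rw [mk_mul_rectT_inv_three, sub_self, ZMod.val_zero, pow_zero, h11, mem_ΦPos_zero, val_sub_one j hj]; rfl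

/-! ### The three local conditions -/

/-- CM: `p c ∈ Φ ↔ p ∉ Φ`. -/
theorem cm_pos (p : TwistGroup (4 * j) (sPos j) (sPos_sq j)) :
    p * tc (4 * j) (sPos j) (sPos_sq j) ∈ ΦPos j ↔ ¬ p ∈ ΦPos j := by
  obtain ⟨l, r⟩ := p
  obtain ⟨a, rfl⟩ := ofAdd.surjective l
  obtain ⟨g, rfl⟩ := ofAdd.surjective r
  show mk (4 * j) (sPos j) (sPos_sq j) a g * tc (4 * j) (sPos j) (sPos_sq j) ∈ ΦPos j ↔
    ¬ mk (4 * j) (sPos j) (sPos_sq j) a g ∈ ΦPos j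
  rw [mk_mul_tc_pos]
  have hv : a.val < 4 * j := ZMod.val_lt a
  rcases (show ∀ y : ZMod 2, y = 0 ∨ y = 1 by decide) g with rfl | rfl
  · rw [mem_ΦPos_zero, mem_ΦPos_zero, val_add_half]
    unfold patZ
    split_ifs <;> omega
  · rw [mem_ΦPos_one, mem_ΦPos_one, val_add_half]
    split_ifs <;> omega

/-- `SumTwo`: exactly two of the four neighbours of every point lie in `Φ`. -/
theorem sumTwo_pos (hj : 1 ≤ j) (p : TwistGroup (4 * j) (sPos j) (sPos_sq j)) :
    (univ.filter fun i : Fin 4 => p * (rectT (4 * j) (sPos j) (sPos_sq j) i)⁻¹ ∈ ΦPos j).card = 2 := by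
  obtain ⟨l, r⟩ := p
  obtain ⟨a, rfl⟩ := ofAdd.surjective l
  obtain ⟨g, rfl⟩ := ofAdd.surjective r
  have e : (⟨ofAdd a, ofAdd g⟩ : TwistGroup (4 * j) (sPos j) (sPos_sq j)) =
      mk (4 * j) (sPos j) (sPos_sq j) a g := rfl
  rw [e, Finset.card_filter, Fin.sum_univ_four]
  have hv : a.val < 4 * j := ZMod.val_lt a
  rcases (show ∀ y : ZMod 2, y = 0 ∨ y = 1 by decide) g with rfl | rfl
  · obtain ⟨h0, h1, h2, h3⟩ := mems_zero j hj a
    rw [if_congr h0 rfl rfl, if_congr h1 rfl rfl, if_congr h2 rfl rfl, if_congr h3 rfl rfl]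
    unfold M2 M3 patZ
    split_ifs <;> omega
  · obtain ⟨h0, h1, h2, h3⟩ := mems_one j hj a
    rw [if_congr h0 rfl rfl, if_congr h1 rfl rfl, if_congr h2 rfl rfl, if_congr h3 rfl rfl]
    unfold M2 M3 patZ
    split_ifs <;> omega

/-- The membership predicate at distance `t_k` from a `⟨v⟩`-point of value `n`. -/
def Mk (k : Fin 4) (n : ℕ) : Prop :=
  match k with
  | 0 => patZ j n
  | 1 => n < 2 * j
  | 2 => M2 j n
  | 3 => M3 j n

/-- `mems_zero` indexed by `k`. -/
theorem mem_mk_zero (hj : 1 ≤ j) (a : ZMod (4 * j)) (k : Fin 4) :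
    mk (4 * j) (sPos j) (sPos_sq j) a 0 * (rectT (4 * j) (sPos j) (sPos_sq j) k)⁻¹ ∈ ΦPos j ↔ Mk j k a.val := by
  obtain ⟨h0, h1, h2, h3⟩ := mems_zero j hj a
  have hfin : ∀ x : Fin 4, x = 0 ∨ x = 1 ∨ x = 2 ∨ x = 3 := by decide
  rcases hfin k with rfl | rfl | rfl | rfl
  · exact h0
  · exact h1
  · exact h2
  · exact h3

/-- A `⟨v⟩`-point `a` separating `Φ t_k` from `c Φ t_i` refutes the conjugate pair `(i, k)`. -/
theorem sep_of (hj : 1 ≤ j) (a : ZMod (4 * j)) (i k : Fin 4)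
    (h : ¬ (Mk j k a.val ↔ Mk j i (a + ((2 * j : ℕ) : ZMod (4 * j))).val)) :
    ¬ ∀ q : TwistGroup (4 * j) (sPos j) (sPos_sq j),
      (q * (rectT (4 * j) (sPos j) (sPos_sq j) k)⁻¹ ∈ ΦPos j ↔
        q * (tc (4 * j) (sPos j) (sPos_sq j) * (rectT (4 * j) (sPos j) (sPos_sq j) i)⁻¹) ∈ ΦPos j) := by
  intro hall
  apply h
  have := hall (mk (4 * j) (sPos j) (sPos_sq j) a 0)
  rwa [← mul_assoc, mk_mul_tc_pos, mem_mk_zero j hj, mem_mk_zero j hj] at this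

/-- The values of the witness points. -/
theorem witness_vals (hj : 2 ≤ j) :
    ((0 : ZMod (4 * j)).val = 0 ∧ ((1 : ℕ) : ZMod (4 * j)).val = 1 ∧ ((2 : ℕ) : ZMod (4 * j)).val = 2) ∧
    (((0 : ZMod (4 * j)) + ((2 * j : ℕ) : ZMod (4 * j))).val = 2 * j ∧
      (((1 : ℕ) : ZMod (4 * j)) + ((2 * j : ℕ) : ZMod (4 * j))).val = 2 * j + 1 ∧
      (((2 : ℕ) : ZMod (4 * j)) + ((2 * j : ℕ) : ZMod (4 * j))).val = 2 * j + 2) := by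
  have h0 : (0 : ZMod (4 * j)).val = 0 := ZMod.val_zero
  have h1 : ((1 : ℕ) : ZMod (4 * j)).val = 1 := val_natCast_lt _ (by omega)
  have h2 : ((2 : ℕ) : ZMod (4 * j)).val = 2 := val_natCast_lt _ (by omega)
  refine ⟨⟨h0, h1, h2⟩, ?_, ?_, ?_⟩ <;> rw [val_add_half] <;> simp only [h0, h1, h2] <;> split_ifs <;> omega

set_option linter.unusedSimpArgs false in
set_option linter.unusedTactic false in
set_option linter.unnecessarySeqFocus false in
/-- No conjugate pair: for every `(i, k)` one of the points `1, v, v²` separates `Φ t_k` from `c Φ t_i`. -/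
theorem noConj_pos (hj : 2 ≤ j) (i k : Fin 4) :
    ¬ ∀ q : TwistGroup (4 * j) (sPos j) (sPos_sq j),
      (q * (rectT (4 * j) (sPos j) (sPos_sq j) k)⁻¹ ∈ ΦPos j ↔
        q * (tc (4 * j) (sPos j) (sPos_sq j) * (rectT (4 * j) (sPos j) (sPos_sq j) i)⁻¹) ∈ ΦPos j) := by
  have hj1 : 1 ≤ j := by omega
  obtain ⟨⟨v0, v1, v2⟩, w0, w1, w2⟩ := witness_vals j hj
  have hfin : ∀ x : Fin 4, x = 0 ∨ x = 1 ∨ x = 2 ∨ x = 3 := by decide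
  rcases hfin i with rfl | rfl | rfl | rfl <;> rcases hfin k with rfl | rfl | rfl | rfl
  · exact sep_of j hj1 (0 : ZMod (4 * j)) 0 0 (by simp only [Mk, M2, M3, patZ, v0, w0]; (try simp only [true_and, and_true, false_and, and_false, true_or, or_true, false_or, or_false, not_true_eq_false, not_false_eq_true, not_not, iff_true, true_iff, iff_false, false_iff]) <;> (intro h; rw [iff_iff_and_or_not_and_not] at h; (try split_ifs at h) <;> omega))
  · exact sep_of j hj1 ((1 : ℕ) : ZMod (4 * j)) 0 1 (by simp only [Mk, M2, M3, patZ, v1, w1]; (try simp only [true_and, and_true, false_and, and_false, true_or, or_true, false_or, or_false, not_true_eq_false, not_false_eq_true, not_not, iff_true, true_iff, iff_false, false_iff]) <;> (intro h; rw [iff_iff_and_or_not_and_not] at h; (try split_ifs at h) <;> omega))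
  · exact sep_of j hj1 (0 : ZMod (4 * j)) 0 2 (by simp only [Mk, M2, M3, patZ, v0, w0]; (try simp only [true_and, and_true, false_and, and_false, true_or, or_true, false_or, or_false, not_true_eq_false, not_false_eq_true, not_not, iff_true, true_iff, iff_false, false_iff]) <;> (intro h; rw [iff_iff_and_or_not_and_not] at h; (try split_ifs at h) <;> omega))
  · exact sep_of j hj1 ((2 : ℕ) : ZMod (4 * j)) 0 3 (by simp only [Mk, M2, M3, patZ, v2, w2]; (try simp only [true_and, and_true, false_and, and_false, true_or, or_true, false_or, or_false, not_true_eq_false, not_false_eq_true, not_not, iff_true, true_iff, iff_false, false_iff]) <;> (intro h; rw [iff_iff_and_or_not_and_not] at h; (try split_ifs at h) <;> omega))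
  · exact sep_of j hj1 ((1 : ℕ) : ZMod (4 * j)) 1 0 (by simp only [Mk, M2, M3, patZ, v1, w1]; (try simp only [true_and, and_true, false_and, and_false, true_or, or_true, false_or, or_false, not_true_eq_false, not_false_eq_true, not_not, iff_true, true_iff, iff_false, false_iff]) <;> (intro h; rw [iff_iff_and_or_not_and_not] at h; (try split_ifs at h) <;> omega))
  · exact sep_of j hj1 (0 : ZMod (4 * j)) 1 1 (by simp only [Mk, M2, M3, patZ, v0, w0]; (try simp only [true_and, and_true, false_and, and_false, true_or, or_true, false_or, or_false, not_true_eq_false, not_false_eq_true, not_not, iff_true, true_iff, iff_false, false_iff]) <;> (intro h; rw [iff_iff_and_or_not_and_not] at h; (try split_ifs at h) <;> omega))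
  · exact sep_of j hj1 ((2 : ℕ) : ZMod (4 * j)) 1 2 (by simp only [Mk, M2, M3, patZ, v2, w2]; (try simp only [true_and, and_true, false_and, and_false, true_or, or_true, false_or, or_false, not_true_eq_false, not_false_eq_true, not_not, iff_true, true_iff, iff_false, false_iff]) <;> (intro h; rw [iff_iff_and_or_not_and_not] at h; (try split_ifs at h) <;> omega))
  · exact sep_of j hj1 (0 : ZMod (4 * j)) 1 3 (by simp only [Mk, M2, M3, patZ, v0, w0]; (try simp only [true_and, and_true, false_and, and_false, true_or, or_true, false_or, or_false, not_true_eq_false, not_false_eq_true, not_not, iff_true, true_iff, iff_false, false_iff]) <;> (intro h; rw [iff_iff_and_or_not_and_not] at h; (try split_ifs at h) <;> omega))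
  · exact sep_of j hj1 (0 : ZMod (4 * j)) 2 0 (by simp only [Mk, M2, M3, patZ, v0, w0]; intro h; exact absurd (h.mpr (by (try split_ifs) <;> omega)) (by (try split_ifs) <;> omega))
  · exact sep_of j hj1 ((2 : ℕ) : ZMod (4 * j)) 2 1 (by simp only [Mk, M2, M3, patZ, v2, w2]; (try simp only [true_and, and_true, false_and, and_false, true_or, or_true, false_or, or_false, not_true_eq_false, not_false_eq_true, not_not, iff_true, true_iff, iff_false, false_iff]) <;> (intro h; rw [iff_iff_and_or_not_and_not] at h; (try split_ifs at h) <;> omega))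
  · exact sep_of j hj1 (0 : ZMod (4 * j)) 2 2 (by simp only [Mk, M2, M3, patZ, v0, w0]; (try simp only [true_and, and_true, false_and, and_false, true_or, or_true, false_or, or_false, not_true_eq_false, not_false_eq_true, not_not, iff_true, true_iff, iff_false, false_iff]) <;> (intro h; rw [iff_iff_and_or_not_and_not] at h; (try split_ifs at h) <;> omega))
  · exact sep_of j hj1 ((1 : ℕ) : ZMod (4 * j)) 2 3 (by simp only [Mk, M2, M3, patZ, v1, w1]; (try simp only [true_and, and_true, false_and, and_false, true_or, or_true, false_or, or_false, not_true_eq_false, not_false_eq_true, not_not, iff_true, true_iff, iff_false, false_iff]) <;> (intro h; rw [iff_iff_and_or_not_and_not] at h; (try split_ifs at h) <;> omega))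
  · exact sep_of j hj1 ((2 : ℕ) : ZMod (4 * j)) 3 0 (by simp only [Mk, M2, M3, patZ, v2, w2]; intro h; exact absurd (h.mpr (by (try split_ifs) <;> omega)) (by (try split_ifs) <;> omega))
  · exact sep_of j hj1 (0 : ZMod (4 * j)) 3 1 (by simp only [Mk, M2, M3, patZ, v0, w0]; (try simp only [true_and, and_true, false_and, and_false, true_or, or_true, false_or, or_false, not_true_eq_false, not_false_eq_true, not_not, iff_true, true_iff, iff_false, false_iff]) <;> (intro h; rw [iff_iff_and_or_not_and_not] at h; (try split_ifs at h) <;> omega))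
  · exact sep_of j hj1 ((1 : ℕ) : ZMod (4 * j)) 3 2 (by simp only [Mk, M2, M3, patZ, v1, w1]; simp only [show ¬ ((1 : ℕ) = 0) by omega, show ¬ (2 * j + 1 + 2 * j < 4 * j + 1) by omega, if_false]; intro h; exact absurd (h.mpr (by omega)) (by omega))
  · exact sep_of j hj1 (0 : ZMod (4 * j)) 3 3 (by simp only [Mk, M2, M3, patZ, v0, w0]; (try simp only [true_and, and_true, false_and, and_false, true_or, or_true, false_or, or_false, not_true_eq_false, not_false_eq_true, not_not, iff_true, true_iff, iff_false, false_iff]) <;> (intro h; rw [iff_iff_and_or_not_and_not] at h; (try split_ifs at h) <;> omega))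

/-! ### The theorem -/

/-- **Theorem T (i), `ε = +`, for EVERY even `k = 2j ≥ 4` (route-2 §9.39; kernel existence).**  For every finite
`(G, c)`, `v` of order `4j` with `v^{2j} = c` and an involution `u ∉ ⟨v⟩` with `u v u⁻¹ = v^{2j+1}` (`= c v`): some
CM type has the twisted rectangle `Φ, Φu, Φv, Φ(vu)` `SumTwo` without a conjugate pair. -/
theorem exists_twistedRectQuad_pos {G : Type*} [Group G] [Fintype G] [DecidableEq G] (hj : 2 ≤ j) {c : G}
    (hc : IsComplexConj c) (v u : G) (hv : orderOf v = 4 * j) (hu : u ^ 2 = 1)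
    (huv : u * v * u⁻¹ = v ^ (2 * j + 1)) (hnot : u ∉ Subgroup.zpowers v) (hcj : v ^ (2 * j) = c) :
    ∃ Φ : Finset G, IsCMType c Φ ∧ SumTwo (fun i => rmul Φ (![1, u, v, v * u] i)) ∧
      ∀ i k : Fin 4, rmul Φ (![1, u, v, v * u] k) ≠ c • rmul Φ (![1, u, v, v * u] i) :=
  exists_twistedRectQuad_of_model (4 * j) hc v u (hs := sPos_sq j) (by omega) hv hu
    (by rw [sPos_val j (by omega)]; exact huv) hnot
    (by rw [show (4 * j) / 2 = 2 * j by omega]; exact hcj) (ΦPos j)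
    (fun p => (decide_eq_decide.mpr (cm_pos j p)).trans decide_not)
    (fun p => by simp only [decide_eq_true_eq]; exact sumTwo_pos j (by omega) p)
    (fun i k h => noConj_pos j hj i k (fun p => by simpa only [decide_eq_true_eq] using h p))

end HodgeRepro.TwistedQuadGen
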